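import Summits.Ventures.CertifiedArithmetic.LowPrec.EnvelopesDirectedE2M1

/-!
# Directed-mode (RZ / RD / RU) normal-range relative constants, destination `E3M2` (sums)

HONEST FRAMING (venture CertifiedArithmetic / cell `pub-lowprec`): certified error envelopes and
provably optimal rounding/accumulation schemes for low-precision formats under stated cost models;
every table by two implementations; no hardware or vendor claims.

The kernel third implementation of the RNE self-destination tables of the nine FP6/FP4 ordered
pairs is `EnvelopesE2M1/E3M2/E2M3`, `EnvelopesMixedE3M2/E2M3`, `EnvelopesMixedFP4`. This file adds
the DIRECTED columns of ENVELOPES.md / paper Table 2 for the three rows `E3M2 ∘ Y → E3M2`,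
`Y ∈ {E3M2, E2M3, E2M1}`, `∘ = +` (by commutativity the enum seat's ordered tables with the
operands exchanged are the transposes; sibling file: the other operation):
for each row and each of `roundTowardZero`
(RZ), `roundDown` (RD), `roundUp` (RU) the SHARP relative constant on the destination's normal
range `1 / 4 ≤ |t| ≤ maxRat` — a bound over all in-range pairs AND an explicit maximiser — by
`decide +kernel` over all operand pairs. `max RU = max RD` on every row (sign symmetry `RU(-t) =
-RD(t)`; both columns are proved with the same constant and each is attained). Constants:
`E3M2+E3M2` RZ 63/319, RD=RU 63/257; `E3M2+E2M3` RZ 31/159, RD=RU 31/129; `E3M2+E2M1` RZ 7/39,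
RD=RU 3/13.
They were computed by an exact evaluator (enum seat, `HOME/lean/enum/dir_envelopes.py`,
Fractions only, no code shared with implementations A/B) and agree with the certified campaign
tables (certs/enum/canary, certs/enum/fp6fp4mixed: implementation A = implementation B = the
referee's route) on all 18 rows × 2 columns. Below the normal range the directed relative error
reaches `1` (results flushed to `0`), so no global constant `< 1` exists; the absolute directed
envelope (`< 1 ulp` per binade) is the generic Theorem E2 (`DirectedEnvelope`).
-/

namespace Summit.Ventures.CertifiedArithmetic

open Literature.ComputerArithmetic.FloatingPoint
open Literature.ComputerArithmetic.FloatingPoint.MiniFloat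
open Literature.ComputerArithmetic.FloatingPoint.Format


/-- `E3M2 + E3M2 → E3M2` under `RZ` (`roundTowardZero`): on the normal range `1 / 4 ≤ |t| ≤ 28`
of `E3M2` every in-range sum satisfies `|fl(t) - t| ≤ 63 / 319 · |t|`, and `63 / 319` is
attained (`a = 1 / 16`, `b = -20`: `t = -319 / 16 ↦ -16`); kernel-exhaustive over all
`64 × 64` ordered pairs. -/
theorem E3M2_E3M2_add_E3M2_relRZ_normal :
    (∀ (a : MiniFloat E3M2) (b : MiniFloat E3M2),
        (1 / 4 : ℚ) ≤ |a.toRat + b.toRat| → |a.toRat + b.toRat| ≤ E3M2.maxRat →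
          |(roundTowardZero E3M2 (a.toRat + b.toRat)).toRat - (a.toRat + b.toRat)|
            ≤ 63 / 319 * |a.toRat + b.toRat|) ∧
      ∃ (a : MiniFloat E3M2) (b : MiniFloat E3M2),
        (1 / 4 : ℚ) ≤ |a.toRat + b.toRat| ∧ |a.toRat + b.toRat| ≤ E3M2.maxRat ∧
          |(roundTowardZero E3M2 (a.toRat + b.toRat)).toRat - (a.toRat + b.toRat)|
            = 63 / 319 * |a.toRat + b.toRat| :=
  ⟨fun a b => of_decide_eq_true (forall₂_of_all_all
      (P := relDirTest E3M2 (roundTowardZero E3M2) (· + ·) (1 / 4) (63 / 319))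
      (by decide +kernel) a b),
    ⟨false, 0, 1, by decide, by decide, by decide⟩,
    ⟨true, 7, 1, by decide, by decide, by decide⟩, by decide +kernel⟩

/-- `E3M2 + E3M2 → E3M2` under `RD` (`roundDown`): on the normal range `1 / 4 ≤ |t| ≤ 28`
of `E3M2` every in-range sum satisfies `|fl(t) - t| ≤ 63 / 257 · |t|`, and `63 / 257` is
attained (`a = -1 / 16`, `b = -16`: `t = -257 / 16 ↦ -20`); kernel-exhaustive over all
`64 × 64` ordered pairs. -/
theorem E3M2_E3M2_add_E3M2_relRD_normal :
    (∀ (a : MiniFloat E3M2) (b : MiniFloat E3M2),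
        (1 / 4 : ℚ) ≤ |a.toRat + b.toRat| → |a.toRat + b.toRat| ≤ E3M2.maxRat →
          |(roundDown E3M2 (a.toRat + b.toRat)).toRat - (a.toRat + b.toRat)|
            ≤ 63 / 257 * |a.toRat + b.toRat|) ∧
      ∃ (a : MiniFloat E3M2) (b : MiniFloat E3M2),
        (1 / 4 : ℚ) ≤ |a.toRat + b.toRat| ∧ |a.toRat + b.toRat| ≤ E3M2.maxRat ∧
          |(roundDown E3M2 (a.toRat + b.toRat)).toRat - (a.toRat + b.toRat)|
            = 63 / 257 * |a.toRat + b.toRat| :=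
  ⟨fun a b => of_decide_eq_true (forall₂_of_all_all
      (P := relDirTest E3M2 (roundDown E3M2) (· + ·) (1 / 4) (63 / 257))
      (by decide +kernel) a b),
    ⟨true, 0, 1, by decide, by decide, by decide⟩,
    ⟨true, 7, 0, by decide, by decide, by decide⟩, by decide +kernel⟩

/-- `E3M2 + E3M2 → E3M2` under `RU` (`roundUp`): on the normal range `1 / 4 ≤ |t| ≤ 28`
of `E3M2` every in-range sum satisfies `|fl(t) - t| ≤ 63 / 257 · |t|`, and `63 / 257` is
attained (`a = 1 / 16`, `b = 16`: `t = 257 / 16 ↦ 20`); kernel-exhaustive over all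
`64 × 64` ordered pairs. -/
theorem E3M2_E3M2_add_E3M2_relRU_normal :
    (∀ (a : MiniFloat E3M2) (b : MiniFloat E3M2),
        (1 / 4 : ℚ) ≤ |a.toRat + b.toRat| → |a.toRat + b.toRat| ≤ E3M2.maxRat →
          |(roundUp E3M2 (a.toRat + b.toRat)).toRat - (a.toRat + b.toRat)|
            ≤ 63 / 257 * |a.toRat + b.toRat|) ∧
      ∃ (a : MiniFloat E3M2) (b : MiniFloat E3M2),
        (1 / 4 : ℚ) ≤ |a.toRat + b.toRat| ∧ |a.toRat + b.toRat| ≤ E3M2.maxRat ∧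
          |(roundUp E3M2 (a.toRat + b.toRat)).toRat - (a.toRat + b.toRat)|
            = 63 / 257 * |a.toRat + b.toRat| :=
  ⟨fun a b => of_decide_eq_true (forall₂_of_all_all
      (P := relDirTest E3M2 (roundUp E3M2) (· + ·) (1 / 4) (63 / 257))
      (by decide +kernel) a b),
    ⟨false, 0, 1, by decide, by decide, by decide⟩,
    ⟨false, 7, 0, by decide, by decide, by decide⟩, by decide +kernel⟩

/-- `E3M2 + E2M3 → E3M2` under `RZ` (`roundTowardZero`): on the normal range `1 / 4 ≤ |t| ≤ 28`
of `E3M2` every in-range sum satisfies `|fl(t) - t| ≤ 31 / 159 · |t|`, and `31 / 159` is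
attained (`a = 20`, `b = -1 / 8`: `t = 159 / 8 ↦ 16`); kernel-exhaustive over all
`64 × 64` ordered pairs. -/
theorem E3M2_E2M3_add_E3M2_relRZ_normal :
    (∀ (a : MiniFloat E3M2) (b : MiniFloat E2M3),
        (1 / 4 : ℚ) ≤ |a.toRat + b.toRat| → |a.toRat + b.toRat| ≤ E3M2.maxRat →
          |(roundTowardZero E3M2 (a.toRat + b.toRat)).toRat - (a.toRat + b.toRat)|
            ≤ 31 / 159 * |a.toRat + b.toRat|) ∧
      ∃ (a : MiniFloat E3M2) (b : MiniFloat E2M3),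
        (1 / 4 : ℚ) ≤ |a.toRat + b.toRat| ∧ |a.toRat + b.toRat| ≤ E3M2.maxRat ∧
          |(roundTowardZero E3M2 (a.toRat + b.toRat)).toRat - (a.toRat + b.toRat)|
            = 31 / 159 * |a.toRat + b.toRat| :=
  ⟨fun a b => of_decide_eq_true (forall₂_of_all_all
      (P := relDirTest E3M2 (roundTowardZero E3M2) (· + ·) (1 / 4) (31 / 159))
      (by decide +kernel) a b),
    ⟨false, 7, 1, by decide, by decide, by decide⟩,
    ⟨true, 0, 1, by decide, by decide, by decide⟩, by decide +kernel⟩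

/-- `E3M2 + E2M3 → E3M2` under `RD` (`roundDown`): on the normal range `1 / 4 ≤ |t| ≤ 28`
of `E3M2` every in-range sum satisfies `|fl(t) - t| ≤ 31 / 129 · |t|`, and `31 / 129` is
attained (`a = -16`, `b = -1 / 8`: `t = -129 / 8 ↦ -20`); kernel-exhaustive over all
`64 × 64` ordered pairs. -/
theorem E3M2_E2M3_add_E3M2_relRD_normal :
    (∀ (a : MiniFloat E3M2) (b : MiniFloat E2M3),
        (1 / 4 : ℚ) ≤ |a.toRat + b.toRat| → |a.toRat + b.toRat| ≤ E3M2.maxRat →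
          |(roundDown E3M2 (a.toRat + b.toRat)).toRat - (a.toRat + b.toRat)|
            ≤ 31 / 129 * |a.toRat + b.toRat|) ∧
      ∃ (a : MiniFloat E3M2) (b : MiniFloat E2M3),
        (1 / 4 : ℚ) ≤ |a.toRat + b.toRat| ∧ |a.toRat + b.toRat| ≤ E3M2.maxRat ∧
          |(roundDown E3M2 (a.toRat + b.toRat)).toRat - (a.toRat + b.toRat)|
            = 31 / 129 * |a.toRat + b.toRat| :=
  ⟨fun a b => of_decide_eq_true (forall₂_of_all_all
      (P := relDirTest E3M2 (roundDown E3M2) (· + ·) (1 / 4) (31 / 129))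
      (by decide +kernel) a b),
    ⟨true, 7, 0, by decide, by decide, by decide⟩,
    ⟨true, 0, 1, by decide, by decide, by decide⟩, by decide +kernel⟩

/-- `E3M2 + E2M3 → E3M2` under `RU` (`roundUp`): on the normal range `1 / 4 ≤ |t| ≤ 28`
of `E3M2` every in-range sum satisfies `|fl(t) - t| ≤ 31 / 129 · |t|`, and `31 / 129` is
attained (`a = 16`, `b = 1 / 8`: `t = 129 / 8 ↦ 20`); kernel-exhaustive over all
`64 × 64` ordered pairs. -/
theorem E3M2_E2M3_add_E3M2_relRU_normal :
    (∀ (a : MiniFloat E3M2) (b : MiniFloat E2M3),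
        (1 / 4 : ℚ) ≤ |a.toRat + b.toRat| → |a.toRat + b.toRat| ≤ E3M2.maxRat →
          |(roundUp E3M2 (a.toRat + b.toRat)).toRat - (a.toRat + b.toRat)|
            ≤ 31 / 129 * |a.toRat + b.toRat|) ∧
      ∃ (a : MiniFloat E3M2) (b : MiniFloat E2M3),
        (1 / 4 : ℚ) ≤ |a.toRat + b.toRat| ∧ |a.toRat + b.toRat| ≤ E3M2.maxRat ∧
          |(roundUp E3M2 (a.toRat + b.toRat)).toRat - (a.toRat + b.toRat)|
            = 31 / 129 * |a.toRat + b.toRat| :=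
  ⟨fun a b => of_decide_eq_true (forall₂_of_all_all
      (P := relDirTest E3M2 (roundUp E3M2) (· + ·) (1 / 4) (31 / 129))
      (by decide +kernel) a b),
    ⟨false, 7, 0, by decide, by decide, by decide⟩,
    ⟨false, 0, 1, by decide, by decide, by decide⟩, by decide +kernel⟩

/-- `E3M2 + E2M1 → E3M2` under `RZ` (`roundTowardZero`): on the normal range `1 / 4 ≤ |t| ≤ 28`
of `E3M2` every in-range sum satisfies `|fl(t) - t| ≤ 7 / 39 · |t|`, and `7 / 39` is
attained (`a = 7 / 16`, `b = 2`: `t = 39 / 16 ↦ 2`); kernel-exhaustive over all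
`64 × 16` ordered pairs. -/
theorem E3M2_E2M1_add_E3M2_relRZ_normal :
    (∀ (a : MiniFloat E3M2) (b : MiniFloat E2M1),
        (1 / 4 : ℚ) ≤ |a.toRat + b.toRat| → |a.toRat + b.toRat| ≤ E3M2.maxRat →
          |(roundTowardZero E3M2 (a.toRat + b.toRat)).toRat - (a.toRat + b.toRat)|
            ≤ 7 / 39 * |a.toRat + b.toRat|) ∧
      ∃ (a : MiniFloat E3M2) (b : MiniFloat E2M1),
        (1 / 4 : ℚ) ≤ |a.toRat + b.toRat| ∧ |a.toRat + b.toRat| ≤ E3M2.maxRat ∧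
          |(roundTowardZero E3M2 (a.toRat + b.toRat)).toRat - (a.toRat + b.toRat)|
            = 7 / 39 * |a.toRat + b.toRat| :=
  ⟨fun a b => of_decide_eq_true (forall₂_of_all_all
      (P := relDirTest E3M2 (roundTowardZero E3M2) (· + ·) (1 / 4) (7 / 39))
      (by decide +kernel) a b),
    ⟨false, 1, 3, by decide, by decide, by decide⟩,
    ⟨false, 2, 0, by decide, by decide, by decide⟩, by decide +kernel⟩

/-- `E3M2 + E2M1 → E3M2` under `RD` (`roundDown`): on the normal range `1 / 4 ≤ |t| ≤ 28`
of `E3M2` every in-range sum satisfies `|fl(t) - t| ≤ 3 / 13 · |t|`, and `3 / 13` is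
attained (`a = -1 / 16`, `b = -4`: `t = -65 / 16 ↦ -5`); kernel-exhaustive over all
`64 × 16` ordered pairs. -/
theorem E3M2_E2M1_add_E3M2_relRD_normal :
    (∀ (a : MiniFloat E3M2) (b : MiniFloat E2M1),
        (1 / 4 : ℚ) ≤ |a.toRat + b.toRat| → |a.toRat + b.toRat| ≤ E3M2.maxRat →
          |(roundDown E3M2 (a.toRat + b.toRat)).toRat - (a.toRat + b.toRat)|
            ≤ 3 / 13 * |a.toRat + b.toRat|) ∧
      ∃ (a : MiniFloat E3M2) (b : MiniFloat E2M1),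
        (1 / 4 : ℚ) ≤ |a.toRat + b.toRat| ∧ |a.toRat + b.toRat| ≤ E3M2.maxRat ∧
          |(roundDown E3M2 (a.toRat + b.toRat)).toRat - (a.toRat + b.toRat)|
            = 3 / 13 * |a.toRat + b.toRat| :=
  ⟨fun a b => of_decide_eq_true (forall₂_of_all_all
      (P := relDirTest E3M2 (roundDown E3M2) (· + ·) (1 / 4) (3 / 13))
      (by decide +kernel) a b),
    ⟨true, 0, 1, by decide, by decide, by decide⟩,
    ⟨true, 3, 0, by decide, by decide, by decide⟩, by decide +kernel⟩

/-- `E3M2 + E2M1 → E3M2` under `RU` (`roundUp`): on the normal range `1 / 4 ≤ |t| ≤ 28`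
of `E3M2` every in-range sum satisfies `|fl(t) - t| ≤ 3 / 13 · |t|`, and `3 / 13` is
attained (`a = 1 / 16`, `b = 4`: `t = 65 / 16 ↦ 5`); kernel-exhaustive over all
`64 × 16` ordered pairs. -/
theorem E3M2_E2M1_add_E3M2_relRU_normal :
    (∀ (a : MiniFloat E3M2) (b : MiniFloat E2M1),
        (1 / 4 : ℚ) ≤ |a.toRat + b.toRat| → |a.toRat + b.toRat| ≤ E3M2.maxRat →
          |(roundUp E3M2 (a.toRat + b.toRat)).toRat - (a.toRat + b.toRat)|
            ≤ 3 / 13 * |a.toRat + b.toRat|) ∧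
      ∃ (a : MiniFloat E3M2) (b : MiniFloat E2M1),
        (1 / 4 : ℚ) ≤ |a.toRat + b.toRat| ∧ |a.toRat + b.toRat| ≤ E3M2.maxRat ∧
          |(roundUp E3M2 (a.toRat + b.toRat)).toRat - (a.toRat + b.toRat)|
            = 3 / 13 * |a.toRat + b.toRat| :=
  ⟨fun a b => of_decide_eq_true (forall₂_of_all_all
      (P := relDirTest E3M2 (roundUp E3M2) (· + ·) (1 / 4) (3 / 13))
      (by decide +kernel) a b),
    ⟨false, 0, 1, by decide, by decide, by decide⟩,
    ⟨false, 3, 0, by decide, by decide, by decide⟩, by decide +kernel⟩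

end Summit.Ventures.CertifiedArithmetic
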